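import Summits.AnomalousDissipation.AnomalousDissipation.Theorems.BaireTransferDenseLoudDesignerForcesErgodicLinearisedVDataExistence
import Summits.AnomalousDissipation.AnomalousDissipation.Theorems.BaireTransferDenseLoudDesignerForcesErgodicGevreySmoothing
import Summits.AnomalousDissipation.AnomalousDissipation.Theorems.BaireTransferDenseLoudDesignerForcesErgodicHyperbolicityKey
import Literature.Analysis.UnboundedOperators.LinearMildCompactness
import Literature.Analysis.UnboundedOperators.DiagonalOperatorCompact
import Literature.Analysis.UnboundedOperators.DiagonalSemigroupCalculus
import Literature.Analysis.FluidPDE.StokesTorusFrameNorm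
import Literature.Analysis.FunctionSpaces.TorusLinearisedNSBackwardUniqueness
import Literature.Analysis.FunctionSpaces.TorusClassicalNSGluing

/-!
# The derivative of the model map is a compact and injective operator at positive times (registered
# tools stub S6d₂b `stub_modelDerivativeCompactInjectiveTools` of block N, line
# `ergodic-budget-selection-closing`, crux `BaireTransfer.DenseLoudDesignerForces`, stmt-AnomalousDissipation-1143)

Summit-side assembly over the accepted vocabulary `ModelFrame` / `IsMild` / `modelMap` (`…ErgodicModelDefs.lean`) and
the landed pieces S6d₂a `stub_modelDerivativeTools` (the derivative `D_s h := D(g s)(y) h` of `g := F.modelMap ν xF U'`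
is continuous on `[0, 3]` and solves the LINEAR mild equation along the orbit), the abstract linear mild equation
(`Literature/Analysis/UnboundedOperators/LinearMildCompactness.lean`, `LinearMildUniqueness.lean`), compact diagonal
operators (`DiagonalOperatorCompact.lean`), L2 `stub_linearisedVDataExistenceTools`, E9 `stub_gevreySmoothingTools`,
S6₁ `stub_framePreimageTools`, L1 `stub_conjugatedLinearisedMildIdentityTools` (via `…ErgodicHyperbolicityKey.lean`,
whose `ModelFrame.hmodes'` is reused), the frame norm identity
(`Literature/Analysis/FluidPDE/StokesTorusFrameNorm.lean`) and backward uniqueness of the linearised Navier–Stokes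
equation (`Literature/Analysis/FunctionSpaces/TorusLinearisedNSBackwardUniqueness.lean`).

COMPACT (`t ∈ (0, 3]`): `D_t = T(νε) D_{t−ε} − R_ε`, `‖R_ε‖ = O(ε^{1/4})` (shifted linear mild identity), the
`T(νε) = diag(e^{-νε mᵢ})`, `mᵢ → ∞`, are compact, `‖D_s‖` is uniformly bounded (singular Grönwall), and norm limits of
compact operators are compact.  INJECTIVE: along the classical orbit `u` (hypothesis `hclass`), for `0 < a` the
background is uniformly Gevrey on `[a, 3]` (E9), L2 gives a classical linearised solution `w` on `(a, a + L]` from the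
finite-enstrophy state `S(D_a h)`, its frame curve `Z` solves the linear mild equation from every `a + ε` (L1) and
`Z(a + ε) → D_a h` (frame norm identity + `L²`/`Ḣ¹` attainment), so `Z = D h` there (`linearMild_eq_of_tendsto'`):
`S(D_s h) = [w s]`.  If `D_t h = 0` then `w t = 0`, `w ≡ 0` before `t` (backward uniqueness), `D_a h = 0` for
`0 < a < t`, and `h = D_0 h = 0` by continuity at `0` (`g 0 = id` on the open `U'`).

References: D. Henry, *Geometric Theory of Semilinear Parabolic Equations* (1981), §7.1, Thm. 1.4.3, Cor. 3.4.6;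
P. Constantin, C. Foias, *Navier–Stokes Equations* (1988), Ch. 12 Thm. 12.2, Ch. 14 (14.2)–(14.6); Z. Lian,
L.-S. Young, JAMS 25 (2012), §1.  Nothing is asserted; no definition is added.
-/

-- `Summit.<Summit>.<Problem>` is the tree's mandated summit-side namespace (CONVENTIONS §2); for this
-- single-conjunct summit the two coincide, so the duplicate is deliberate.
set_option linter.dupNamespace false

noncomputable section

open Set Function MeasureTheory Filter
open scoped InnerProductSpace Topology ENNReal ContDiff

namespace Summit.AnomalousDissipation.AnomalousDissipation.Theorems.DenseLoudDesignerForces.Ergodic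

open Literature.Analysis.FunctionSpaces Literature.Analysis.FunctionSpaces.Torus
open Literature.Analysis.FluidPDE Literature.Analysis.FluidPDE.Torus
open Literature.Analysis.UnboundedOperators
open Summit.AnomalousDissipation.AnomalousDissipation.Theorems.DenseLoudDesignerForces.Negative

/-- **`T(τ) = e^{-τA}` is a compact operator for `τ > 0`**: it is the diagonal operator `diag(e^{-τ mᵢ})` in the
Stokes mode basis (`eq_diagonalCLM_of_forall_basis`) with symbol `→ 0` along the cofinite filter (`mᵢ → ∞`), so
`HilbertBasis.isCompactOperator_diagonalCLM_of_tendsto_zero` applies (Constantin–Foias 1988, Ch. 4). [folklore] -/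
theorem ModelFrame.isCompactOperator_T (F : ModelFrame) {τ : ℝ} (hτ : 0 < τ) : IsCompactOperator (F.T τ) := by
  obtain ⟨σ, hσ⟩ := exists_lp_rpow_mul_exp_neg (m := F.m) (fun i => (F.hpos i).le) le_rfl
  have hTσ : F.T τ = F.b.diagonalCLM (σ τ) :=
    eq_diagonalCLM_of_forall_basis F.b fun i => by rw [F.hT τ i hτ.le, hσ τ i hτ, Real.rpow_zero, one_mul]
  rw [hTσ]
  refine F.b.isCompactOperator_diagonalCLM_of_tendsto_zero (σ τ) ?_
  have h : Tendsto (fun i => Real.exp (-(τ * F.m i))) cofinite (𝓝 0) :=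
    Real.tendsto_exp_neg_atTop_nhds_zero.comp (F.htend.const_mul_atTop hτ)
  refine (tendsto_zero_iff_norm_tendsto_zero.1 h).congr fun i => ?_
  rw [hσ τ i hτ, Real.rpow_zero, one_mul]

/-- **The orbit is a continuous curve**: for `y ∈ U` the admissible mild solution `z` on `[0, 3]` computes the
model map, `g r y = z r` on `[0, 3]` (restriction + uniqueness, `ModelFrame.modelMap_eq_of_isMild`). [folklore] -/
theorem continuousOn_modelMap_orbit (F : ModelFrame) {ν : ℝ} (hν : 0 < ν) (xF : Hsp) {U U' : Set Hsp}
    (htube : ∀ y ∈ U, ∀ t ∈ Icc (0 : ℝ) 3, ∃ (ht : 0 ≤ t) (z : C(Icc (0 : ℝ) t, Hsp)),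
      F.IsMild ν xF ht y z ∧ (∀ r, z r ∈ U') ∧ F.modelMap ν xF U' t y = z ⟨t, ht, le_rfl⟩) {y : Hsp} (hy : y ∈ U) :
    ContinuousOn (fun r : ℝ => F.modelMap ν xF U' r y) (Icc 0 3) := by
  obtain ⟨h3, z, hz, hzU', -⟩ := htube y hy 3 (right_mem_Icc.2 zero_le_three)
  have heq : ∀ (r : ℝ) (hr : r ∈ Icc (0 : ℝ) 3), F.modelMap ν xF U' r y = z ⟨r, hr⟩ := fun r hr => by
    obtain ⟨z', hz', hz'eq⟩ := hz.restrict hr.1 hr.2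
    rw [F.modelMap_eq_of_isMild hν hr.1 hz' fun r' => by rw [hz'eq r']; exact hzU' _, hz'eq]
  rw [continuousOn_iff_continuous_restrict]
  have he : (Icc (0 : ℝ) 3).restrict (fun r : ℝ => F.modelMap ν xF U' r y) = fun r => z r :=
    funext fun r => heq r r.2
  rw [he]
  exact z.continuous

/-- Continuity of the symmetrised bilinear source `r ↦ Nb (G r) (Z r) + Nb (Z r) (G r)` along two continuous
curves (joint continuity of the bounded bilinear `Nb`). [folklore] -/
theorem ModelFrame.continuousOn_nb_symm (F : ModelFrame) {G Z : ℝ → Hsp} {s : Set ℝ} (hG : ContinuousOn G s)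
    (hZ : ContinuousOn Z s) : ContinuousOn (fun r => F.Nb (G r) (Z r) + F.Nb (Z r) (G r)) s :=
  (F.Nb.continuous₂.comp_continuousOn (hG.prodMk hZ)).add (F.Nb.continuous₂.comp_continuousOn (hZ.prodMk hG))

set_option maxHeartbeats 400000 in
/-- **The linear mild package of the derivative of the model map** (S6d₂a `stub_modelDerivativeTools` with the
coefficient operators `B(s) = Nb (g s y) · + Nb · (g s y)`): bounded coefficients, continuity of `s ↦ D(g s)(y) x`
and of the sources, the identity `D(g t)(y) x = T(νt) x − ∫₀ᵗ K(ν(t−s)) B(s) D(g s)(y) x ds` on `[0, 3]`, and the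
uniform bound on `‖D(g s)(y)‖` (`exists_forall_norm_le_of_linearMild`, Henry 1981, Lemma 7.1.1). [folklore] -/
theorem exists_linearMild_fderiv_modelMap (F : ModelFrame) {ν : ℝ} (hν : 0 < ν) (xF : Hsp) {U U' : Set Hsp}
    (hU : IsOpen U) (hU' : IsOpen U') (hUU' : U ⊆ U')
    (htube : ∀ y ∈ U, ∀ t ∈ Icc (0 : ℝ) 3, ∃ (ht : 0 ≤ t) (z : C(Icc (0 : ℝ) t, Hsp)),
      F.IsMild ν xF ht y z ∧ (∀ r, z r ∈ U') ∧ F.modelMap ν xF U' t y = z ⟨t, ht, le_rfl⟩) {y : Hsp} (hy : y ∈ U) :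
    ∃ (B : ℝ → Hsp →L[ℝ] Hsp) (β M : ℝ), (∀ s ∈ Icc (0 : ℝ) 3, ‖B s‖ ≤ β) ∧
      (∀ (s : ℝ) (x : Hsp), B s x = F.Nb (F.modelMap ν xF U' s y) x + F.Nb x (F.modelMap ν xF U' s y)) ∧
      (∀ s ∈ Icc (0 : ℝ) 3, ‖fderiv ℝ (fun y' => F.modelMap ν xF U' s y') y‖ ≤ M) ∧
      (∀ x : Hsp, ContinuousOn (fun s : ℝ => fderiv ℝ (fun y' => F.modelMap ν xF U' s y') y x) (Icc 0 3)) ∧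
      (∀ x : Hsp, ContinuousOn (fun s : ℝ => B s (fderiv ℝ (fun y' => F.modelMap ν xF U' s y') y x)) (Icc 0 3)) ∧
      ∀ (x : Hsp), ∀ t ∈ Icc (0 : ℝ) 3, fderiv ℝ (fun y' => F.modelMap ν xF U' t y') y x = F.T (ν * t) x -
        ∫ s in (0 : ℝ)..t, F.K (ν * (t - s)) (B s (fderiv ℝ (fun y' => F.modelMap ν xF U' s y') y x)) := by
  have hder := stub_modelDerivativeTools F hν xF hU hU' hUU' htube y hy
  have hGc := continuousOn_modelMap_orbit F hν xF htube hy
  -- the coefficients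
  obtain ⟨B, hB⟩ : ∃ B : ℝ → Hsp →L[ℝ] Hsp,
      B = fun s => F.Nb (F.modelMap ν xF U' s y) + F.Nb.flip (F.modelMap ν xF U' s y) := ⟨_, rfl⟩
  have hBapp : ∀ (s : ℝ) (x : Hsp), B s x = F.Nb (F.modelMap ν xF U' s y) x + F.Nb x (F.modelMap ν xF U' s y) :=
    fun s x => by rw [hB]; simp only [add_apply, ContinuousLinearMap.flip_apply]
  have hcomp : ∀ x : Hsp, ContinuousOn (fun s : ℝ => B s (fderiv ℝ (fun y' => F.modelMap ν xF U' s y') y x))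
      (Icc 0 3) := fun x =>
    (F.continuousOn_nb_symm hGc (hder x).1).congr fun s _ => hBapp s _
  -- a bound for the orbit and for the coefficients
  obtain ⟨R, hR⟩ := (isCompact_Icc.image_of_continuousOn hGc).isBounded.exists_norm_le
  have hRb : ∀ s ∈ Icc (0 : ℝ) 3, ‖F.modelMap ν xF U' s y‖ ≤ R := fun s hs => hR _ (mem_image_of_mem _ hs)
  have hR0 : 0 ≤ R := (norm_nonneg _).trans (hRb 0 ⟨le_rfl, zero_le_three⟩)
  obtain ⟨C, hC0, hC⟩ := F.Nb.isBoundedBilinearMap.bound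
  have hBn : ∀ s ∈ Icc (0 : ℝ) 3, ‖B s‖ ≤ 2 * C * R := fun s hs => by
    refine ContinuousLinearMap.opNorm_le_bound _ (by positivity) fun x => ?_
    rw [hBapp]
    calc ‖F.Nb (F.modelMap ν xF U' s y) x + F.Nb x (F.modelMap ν xF U' s y)‖
        ≤ C * ‖F.modelMap ν xF U' s y‖ * ‖x‖ + C * ‖x‖ * ‖F.modelMap ν xF U' s y‖ :=
          (norm_add_le _ _).trans (add_le_add (hC _ _) (hC _ _))
      _ ≤ C * R * ‖x‖ + C * ‖x‖ * R := by gcongr <;> exact hRb s hs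
      _ = 2 * C * R * ‖x‖ := by ring
  -- the identity in coefficient form
  have hid : ∀ (x : Hsp), ∀ t ∈ Icc (0 : ℝ) 3, fderiv ℝ (fun y' => F.modelMap ν xF U' t y') y x = F.T (ν * t) x -
      ∫ s in (0 : ℝ)..t, F.K (ν * (t - s)) (B s (fderiv ℝ (fun y' => F.modelMap ν xF U' s y') y x)) := by
    intro x t ht
    refine ((hder x).2 t ht).trans (congrArg (fun I : Hsp => F.T (ν * t) x - I)
      (intervalIntegral.integral_congr fun s _ => ?_))
    simp only [hBapp]
  -- the a priori bound
  obtain ⟨Lip, hLip1, hLip⟩ := exists_forall_norm_le_of_linearMild (fun t => F.T (ν * t)) (fun t => F.K (ν * t))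
    (F.norm_T_mul_le hν.le) (by norm_num : (3 / 4 : ℝ) < 1) (Real.rpow_nonneg hν.le _) (F.norm_K_mul_le hν)
    (F.continuousOn_K_mul hν) (2 * C * R) 3
  refine ⟨B, 2 * C * R, Lip, hBn, hBapp, fun s hs => ?_, fun x => (hder x).1, hcomp, hid⟩
  refine ContinuousLinearMap.opNorm_le_bound _ (zero_le_one.trans hLip1) fun x => ?_
  exact hLip 3 le_rfl B (fun r => fderiv ℝ (fun y' => F.modelMap ν xF U' r y') y x) x hBn (hder x).1 (hcomp x)
    (hid x) s hs

/-- **Frame-norm distance to an honest state**: if `S Z = [v]` for a smooth divergence-free mean-zero `v`, then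
`‖Z − x‖² = ∫‖v − rep (S x)‖² + ‖∇(v − rep (S x))‖₂²` (`Torus.norm_sub_sq_eq_frame` on representatives). [folklore] -/
theorem ModelFrame.norm_sub_sq_of_frame_eq_stateOf (F : ModelFrame) {Z x : Hsp}
    {v : (UnitAddTorus (Fin 3)) → (EuclideanSpace ℝ (Fin 3))} (hv : IsSmooth v) (hd : IsDivFree v) (hm : HasZeroMean v)
    (hZ : F.S Z = stateOf v) :
    ‖Z - x‖ ^ 2 = (∫ ξ, ‖v ξ - rep (F.S x) ξ‖ ^ 2) + (eGradNormSq (v - rep (F.S x))).toReal := by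
  have h := norm_sub_sq_eq_frame F.b F.m F.hmodes' F.S F.hS Z x
  rw [hZ] at h
  have hae : (fun ξ => rep (stateOf v) ξ - rep (F.S x) ξ) =ᵐ[volume] fun ξ => v ξ - rep (F.S x) ξ := by
    filter_upwards [rep_stateOf hv hd hm] with ξ hξ
    rw [hξ]
  have hae' : (rep (stateOf v) - rep (F.S x)) =ᵐ[volume] v - rep (F.S x) := hae
  have hrep : rep (stateOf v - F.S x) =ᵐ[volume] fun ξ => v ξ - rep (F.S x) ξ := by
    have h1 : rep (stateOf v - F.S x) =ᵐ[volume] fun ξ => rep (stateOf v) ξ - rep (F.S x) ξ := by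
      show (((stateOf v - F.S x : Hsp) : Lp (EuclideanSpace ℝ (Fin 3)) 2 (volume : Measure (UnitAddTorus (Fin 3)))) :
          (UnitAddTorus (Fin 3)) → (EuclideanSpace ℝ (Fin 3))) =ᵐ[volume] _
      rw [Submodule.coe_sub]
      exact Lp.coeFn_sub _ _
    exact h1.trans hae
  rw [h, stub_trajectoryPowerBudget_aux_norm_sq _ hrep]
  exact congrArg₂ (· + ·) rfl (congrArg ENNReal.toReal (Literature.Analysis.FluidPDE.eGradNormSq_congr_ae hae'))

/-- **Identification of the derivative of the model map with classical linearised solutions.**  For `y ∈ U` with a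
classical orbit `u` on `(0, 3]` (`S (g t y) = [u t]`, zero-mean slices, enstrophy `≤ E₂`, force `f_c`), `h ∈ Hsp`,
`0 < a`, `0 < L`, `a + L ≤ 3`, there is a classical linearised solution `(w, q)` along `u` on `(a, a + L]` with
`S (D(g s)(y) h) = [w s]`: `u` is uniformly Gevrey on `[a, a + L]` (E9 on `[s − a/2, s]`), L2 yields `(w, q)` from
the finite-enstrophy state `S (D(g a)(y) h)` attaining it in `L²`/`Ḣ¹`, the frame curve `Z s = S([w s] − [Δ w s])`
(S6₁) solves the linear mild equation from every `a + ε` (L1) with `Z(a + ε) → D(g a)(y) h` (frame norm identity),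
and `linearMild_eq_of_tendsto'` identifies it with `s ↦ D(g s)(y) h` (Constantin–Foias 1988, Ch. 14 (14.2)–(14.4);
Henry 1981, Cor. 3.4.6). [folklore] -/
theorem exists_linearised_stateOf_fderiv_modelMap (F : ModelFrame) {ν : ℝ} (hν : 0 < ν) (xF : Hsp) {U U' : Set Hsp}
    (hU : IsOpen U) (hU' : IsOpen U') (hUU' : U ⊆ U')
    (htube : ∀ y ∈ U, ∀ t ∈ Icc (0 : ℝ) 3, ∃ (ht : 0 ≤ t) (z : C(Icc (0 : ℝ) t, Hsp)),
      F.IsMild ν xF ht y z ∧ (∀ r, z r ∈ U') ∧ F.modelMap ν xF U' t y = z ⟨t, ht, le_rfl⟩)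
    {S : Finset (Fin 3 → ℤ)} {c : ↥S → (EuclideanSpace ℂ (Fin 3))} {y : Hsp} (hy : y ∈ U)
    {u : ℝ → (UnitAddTorus (Fin 3)) → (EuclideanSpace ℝ (Fin 3))} {p : ℝ → (UnitAddTorus (Fin 3)) → ℝ} {E₂ : ℝ}
    (hsol : IsClassicalNSSolutionOn (Ioc 0 3) ν (fun _ => force S c) u p)
    (humean : ∀ t ∈ Ioc (0 : ℝ) 3, HasZeroMean (u t)) (hE : ∀ t ∈ Ioc (0 : ℝ) 3, gradNormSq (u t) ≤ E₂)
    (horb : ∀ t ∈ Ioc (0 : ℝ) 3, F.S (F.modelMap ν xF U' t y) = stateOf (u t)) (h : Hsp)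
    {a L : ℝ} (ha : 0 < a) (hL : 0 < L) (haL : a + L ≤ 3) :
    ∃ (w : ℝ → (UnitAddTorus (Fin 3)) → (EuclideanSpace ℝ (Fin 3))) (q : ℝ → (UnitAddTorus (Fin 3)) → ℝ),
      IsLinearizedNSSolutionOn (Ioc a (a + L)) ν u w q ∧
      ∀ s ∈ Ioc a (a + L), F.S (fderiv ℝ (fun y' => F.modelMap ν xF U' s y') y h) = stateOf (w s) := by
  have hα : (3 / 4 : ℝ) < 1 := by norm_num
  obtain ⟨B, β, M, hBn, hBapp, -, hDc, hcomp, hid⟩ := exists_linearMild_fderiv_modelMap F hν xF hU hU' hUU' htube hy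
  obtain ⟨D, hD⟩ : ∃ D : ℝ → Hsp →L[ℝ] Hsp, D = fun s => fderiv ℝ (fun y' => F.modelMap ν xF U' s y') y := ⟨_, rfl⟩
  have hDc' : ContinuousOn (fun s => D s h) (Icc 0 3) := by rw [hD]; exact hDc h
  have hcomp' : ContinuousOn (fun s => B s (D s h)) (Icc 0 3) := by rw [hD]; exact hcomp h
  have hid' : ∀ t ∈ Icc (0 : ℝ) 3, D t h = F.T (ν * t) h - ∫ s in (0 : ℝ)..t, F.K (ν * (t - s)) (B s (D s h)) := by
    rw [hD]; exact hid h
  have hGc := continuousOn_modelMap_orbit F hν xF htube hy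
  have hIcc : Icc a (a + L) ⊆ Ioc 0 3 := fun s hs => ⟨ha.trans_le hs.1, hs.2.trans haL⟩
  have hIoc : Ioc a (a + L) ⊆ Ioc 0 3 := fun s hs => ⟨ha.trans hs.1, hs.2.trans haL⟩
  have hu : IsSmoothSpaceTimeOn (Icc a (a + L)) u := hsol.smooth_velocity.mono hIcc
  have hudiv : ∀ t ∈ Icc a (a + L), IsDivFree (u t) := fun t ht => hsol.divFree t (hIcc ht)
  have humean' : ∀ t ∈ Icc a (a + L), HasZeroMean (u t) := fun t ht => humean t (hIcc ht)
  -- (1) the background is uniformly Gevrey on `[a, a + L]` (E9 on the windows `[s − a/2, s]`)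
  obtain ⟨σ, hσ, Cg, hCg⟩ := stub_gevreySmoothingTools hν E₂ (a / 2) (half_pos ha) S fun k => lerayCoeff k (coeffExt S c k)
  have hGev : ∀ s ∈ Icc a (a + L), ∀ S' : Finset (Fin 3 → ℤ), ∑ k ∈ S', Real.exp (2 * σ * Real.sqrt (freqNormSq k)) *
      ‖UnitAddTorus.mFourierCoeff (EuclideanSpace.complexify ∘ u s) k‖ ^ 2 ≤ Cg := by
    intro s hs S'
    have hsub : Icc (s - a / 2) (s - a / 2 + a / 2) ⊆ Ioc 0 3 := fun r hr =>
      ⟨by linarith only [hr.1, hs.1, ha], by linarith only [hr.2, hs.2, haL]⟩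
    have h1 := hCg (hsol.mono hsub (uniqueDiffOn_Icc (by linarith only [ha]))) (fun r hr => humean r (hsub hr))
      (fun r hr => hE r (hsub hr)) S'
    rwa [sub_add_cancel] at h1
  -- (2) the classical linearised solution from the finite-enstrophy state `S (D a h)` (L2)
  obtain ⟨CL, hCL⟩ := stub_linearisedVDataExistenceTools hν hL hu hudiv humean' hσ hGev
  have hfin : eGradNormSq (rep (F.S (D a h))) ≠ ⊤ :=
    ne_top_of_le_ne_top ENNReal.ofReal_ne_top (eGradNormSq_frame_le F.b F.m F.hmodes' F.S F.hS (D a h))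
  obtain ⟨w, q, hlin, -, hL2, hH1⟩ := hCL (F.S (D a h)) hfin
  have hws : ∀ s ∈ Ioc a (a + L), IsSmooth (w s) := fun s hs => hlin.1.isSmooth_slice hs
  -- (3) its frame curve (S6₁)
  obtain ⟨Z, hZdef⟩ : ∃ Z : ℝ → Hsp, Z = fun s => F.S (stateOf (w s) - stateOf (laplacian (w s))) := ⟨_, rfl⟩
  have hZ : ∀ s ∈ Ioc a (a + L), F.S (Z s) = stateOf (w s) := fun s hs => by
    rw [hZdef]
    exact stub_framePreimageTools F.ι F.b F.m F.hmodes F.S F.hS (hws s hs) (hlin.2.2.1 s hs) (hlin.2.2.2.1 s hs)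
  -- (4) the frame curve attains `D a h` at `a⁺` (frame norm identity + `L²`/`Ḣ¹` attainment)
  have hZlim : Tendsto Z (𝓝[>] a) (𝓝 (D a h)) := by
    have hf : Tendsto (fun s => (∫ ξ, ‖w s ξ - rep (F.S (D a h)) ξ‖ ^ 2) +
        (eGradNormSq (w s - rep (F.S (D a h)))).toReal) (𝓝[>] a) (𝓝 (0 + (0 : ℝ≥0∞).toReal)) :=
      hL2.add ((ENNReal.tendsto_toReal ENNReal.zero_ne_top).comp hH1)
    rw [ENNReal.toReal_zero, add_zero] at hf
    have hev : ∀ᶠ s in 𝓝[>] a, Real.sqrt ((∫ ξ, ‖w s ξ - rep (F.S (D a h)) ξ‖ ^ 2) +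
        (eGradNormSq (w s - rep (F.S (D a h)))).toReal) = ‖Z s - D a h‖ := by
      filter_upwards [Ioc_mem_nhdsGT (show a < a + L by linarith only [hL])] with s hs
      rw [← F.norm_sub_sq_of_frame_eq_stateOf (hws s hs) (hlin.2.2.1 s hs) (hlin.2.2.2.1 s hs) (hZ s hs),
        Real.sqrt_sq (norm_nonneg _)]
    have h1 := hf.sqrt
    rw [Real.sqrt_zero] at h1
    exact tendsto_iff_norm_sub_tendsto_zero.2 (h1.congr' hev)
  -- (5) identification on `(a, a + L]` by `linearMild_eq_of_tendsto'`
  have hshiftI : ∀ r ∈ Icc 0 L, a + r ∈ Icc (0 : ℝ) 3 := fun r hr =>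
    ⟨by linarith only [hr.1, ha], by linarith only [hr.2, haL]⟩
  have hca : Continuous fun r : ℝ => a + r := continuous_const.add continuous_id
  have hzc : ∀ ε ∈ Ioo 0 L, ContinuousOn (fun r => Z (a + r)) (Icc ε L) := by
    intro ε hε
    have hsub : Icc (a + ε) (a + ε + (L - ε)) ⊆ Ioc a (a + L) := fun s hs =>
      ⟨by linarith only [hs.1, hε.1], by linarith only [hs.2]⟩
    have hlin' := hlin.mono hsub (uniqueDiffOn_Icc (by linarith only [hε.2]))
    have hc := F.continuousOn_frameCurve (sub_pos.2 hε.2) hlin'.1 hlin'.2.2.1 hlin'.2.2.2.1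
      (x := fun r => Z (a + ε + r)) fun r hr => hZ _ (hsub ⟨by linarith only [hr.1], by linarith only [hr.2]⟩)
    refine (hc.comp (continuous_sub_right ε).continuousOn fun r hr =>
      ⟨by linarith only [hr.1], by linarith only [hr.2]⟩).congr fun r _ => ?_
    exact congrArg Z (by ring)
  have hident : ∀ r ∈ Ioc 0 L, Z (a + r) = D (a + r) h := by
    refine linearMild_eq_of_tendsto' (fun t => F.T (ν * t)) (fun t => F.K (ν * t)) (F.norm_T_mul_le hν.le)
      (F.T_mul_add hν.le) hα (Real.rpow_nonneg hν.le _) (F.norm_K_mul_le hν) (F.K_mul_add hν) (F.continuousOn_K_mul hν)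
      (B := fun s => B (a + s)) (fun s hs => hBn _ (hshiftI s hs)) (u := fun r => D (a + r) h) (z := fun r => Z (a + r))
      (hDc'.comp hca.continuousOn hshiftI) (hcomp'.comp hca.continuousOn hshiftI) ?_ ?_ ?_ ?_ ?_
    · -- the shifted identity for `D` from `a`
      intro r hr
      have h1 := linearMild_shift hα (F.T_mul_add hν.le) (F.norm_K_mul_le hν) (F.K_mul_add hν)
        (F.continuousOn_K_mul hν) hcomp' ha.le (by linarith only [haL, hL] : a ≤ 3) hid' r
        ⟨hr.1, by linarith only [hr.2, haL]⟩
      simpa only [add_zero] using h1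
    · exact hzc
    · -- continuity of the source along the frame curve on `[ε, L]`
      exact fun ε hε => (F.continuousOn_nb_symm (hGc.comp hca.continuousOn fun r hr =>
        hshiftI r ⟨hε.1.le.trans hr.1, hr.2⟩) (hzc ε hε)).congr fun r _ => hBapp _ _
    · -- the identity for the frame curve from `ε` (L1 on `[a + ε, a + L]`)
      intro ε hε t ht
      have hsub : Icc (a + ε) (a + ε + (L - ε)) ⊆ Ioc a (a + L) := fun s hs =>
        ⟨by linarith only [hs.1, hε.1], by linarith only [hs.2]⟩
      have hlin' := hlin.mono hsub (uniqueDiffOn_Icc (by linarith only [hε.2]))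
      have hmem : ∀ r ∈ Icc 0 (L - ε), a + ε + r ∈ Ioc a (a + L) := fun r hr =>
        hsub ⟨by linarith only [hr.1], by linarith only [hr.2]⟩
      have h1 := stub_conjugatedLinearisedMildIdentityTools F hν (sub_pos.2 hε.2) (hu.mono (hsub.trans Ioc_subset_Icc_self))
        (fun r hr => hudiv r (Ioc_subset_Icc_self (hsub hr))) (fun r hr => humean' r (Ioc_subset_Icc_self (hsub hr)))
        hlin' (fun r => F.modelMap ν xF U' (a + ε + r) y) (fun r hr => horb _ (hIoc (hmem r hr)))
        (fun r => Z (a + ε + r)) (fun r hr => hZ _ (hmem r hr)) (t - ε) ⟨sub_nonneg.2 ht.1, by linarith only [ht.2]⟩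
      have e1 : a + ε + (t - ε) = a + t := by ring
      rw [e1, add_zero] at h1
      refine h1.trans (congrArg (fun I : Hsp => F.T (ν * (t - ε)) (Z (a + ε)) - I)
        (intervalIntegral.integral_congr fun r _ => ?_))
      simp only [hBapp, add_assoc]
    · have h1 : Tendsto (fun r : ℝ => a + r) (𝓝[>] 0) (𝓝[>] a) := by
        refine tendsto_nhdsWithin_of_tendsto_nhds_of_eventually_within _ ?_ ?_
        · simpa only [add_zero] using (hca.tendsto 0).mono_left nhdsWithin_le_nhds
        · filter_upwards [self_mem_nhdsWithin] with r hr using by simpa using hr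
      simpa only [add_zero, Function.comp_def] using hZlim.comp h1
  refine ⟨w, q, hlin, fun s hs => ?_⟩
  have h1 := hident (s - a) ⟨by linarith only [hs.1], by linarith only [hs.2]⟩
  rw [add_sub_cancel] at h1
  rw [← hZ s hs, h1, hD]

/-- **The derivative `D(g t)(y)` is injective for `t ∈ (0, 3]` along a classical orbit** (backward uniqueness,
Constantin–Foias 1988, Ch. 12 Thm. 12.2 / Ch. 14 (14.5)–(14.6)): if `D(g t)(y) h = 0` then for `0 < a' < t` the
linearised solution `w` on `(a'/2, t]` identified with `s ↦ D(g s)(y) h` vanishes at `t`, hence on `[a', t]`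
(`Torus.linearisedNS_backward_eq_zero`), so `D(g a')(y) h = 0` (`S` injective); as `a' → 0⁺`, `h = D(g 0)(y) h = 0`
(continuity at `0`, `g 0 = id` on the open `U'`). [folklore] -/
theorem injective_fderiv_modelMap (F : ModelFrame) {ν : ℝ} (hν : 0 < ν) (xF : Hsp) {U U' : Set Hsp}
    (hU : IsOpen U) (hU' : IsOpen U') (hUU' : U ⊆ U')
    (htube : ∀ y ∈ U, ∀ t ∈ Icc (0 : ℝ) 3, ∃ (ht : 0 ≤ t) (z : C(Icc (0 : ℝ) t, Hsp)),
      F.IsMild ν xF ht y z ∧ (∀ r, z r ∈ U') ∧ F.modelMap ν xF U' t y = z ⟨t, ht, le_rfl⟩)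
    {S : Finset (Fin 3 → ℤ)} {c : ↥S → (EuclideanSpace ℂ (Fin 3))} {y : Hsp} (hy : y ∈ U)
    {u : ℝ → (UnitAddTorus (Fin 3)) → (EuclideanSpace ℝ (Fin 3))} {p : ℝ → (UnitAddTorus (Fin 3)) → ℝ} {E₂ : ℝ}
    (hsol : IsClassicalNSSolutionOn (Ioc 0 3) ν (fun _ => force S c) u p)
    (humean : ∀ t ∈ Ioc (0 : ℝ) 3, HasZeroMean (u t)) (hE : ∀ t ∈ Ioc (0 : ℝ) 3, gradNormSq (u t) ≤ E₂)
    (horb : ∀ t ∈ Ioc (0 : ℝ) 3, F.S (F.modelMap ν xF U' t y) = stateOf (u t)) {t : ℝ} (ht : t ∈ Ioc (0 : ℝ) 3) :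
    Function.Injective (fderiv ℝ (fun y' => F.modelMap ν xF U' t y') y) := by
  refine (injective_iff_map_eq_zero _).2 fun h h0 => ?_
  -- (1) `D(g a')(y) h = 0` for all `0 < a' < t`
  have hzero : ∀ a' ∈ Ioo 0 t, fderiv ℝ (fun y' => F.modelMap ν xF U' a' y') y h = 0 := by
    intro a' ha'
    obtain ⟨w, q, hlin, hZ⟩ := exists_linearised_stateOf_fderiv_modelMap F hν xF hU hU' hUU' htube hy hsol humean hE
      horb h (a := a' / 2) (L := t - a' / 2) (half_pos ha'.1) (by linarith only [ha'.1, ha'.2]) (by linarith only [ht.2])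
    have e : a' / 2 + (t - a' / 2) = t := by ring
    rw [e] at hlin hZ
    have htm : t ∈ Ioc (a' / 2) t := ⟨by linarith only [ha'.1, ha'.2], le_rfl⟩
    have ham : a' ∈ Ioc (a' / 2) t := ⟨by linarith only [ha'.1], ha'.2.le⟩
    -- `w t = 0`
    have hwt : w t = 0 := by
      have hst : stateOf (w t) = 0 := by rw [← hZ t htm, h0, map_zero]
      have hae : w t =ᵐ[volume] fun _ => (0 : EuclideanSpace ℝ (Fin 3)) := by
        have h1 := rep_stateOf (hlin.1.isSmooth_slice htm) (hlin.2.2.1 t htm) (hlin.2.2.2.1 t htm)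
        rw [hst] at h1
        have h2 : rep (0 : Hsp) =ᵐ[volume] fun _ => (0 : EuclideanSpace ℝ (Fin 3)) := by
          show ⇑(((0 : Hsp) : Lp (EuclideanSpace ℝ (Fin 3)) 2 (volume : Measure (UnitAddTorus (Fin 3))))) =ᵐ[volume] _
          rw [Submodule.coe_zero]
          exact Lp.coeFn_zero _ _ _
        exact h1.symm.trans h2
      exact eq_of_ae_eq_of_isSmooth (hlin.1.isSmooth_slice htm) (isSmooth_const _) hae
    -- backward uniqueness on `[a', t]`
    have hsub : Icc a' t ⊆ Ioc (a' / 2) t := fun s hs => ⟨by linarith only [hs.1, ha'.1], hs.2⟩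
    have hlin' := hlin.mono hsub (uniqueDiffOn_Icc ha'.2)
    have hsub3 : Icc a' t ⊆ Ioc 0 3 := fun s hs => ⟨ha'.1.trans_le hs.1, hs.2.trans ht.2⟩
    have hw0 := linearisedNS_backward_eq_zero hν ha'.2 (hsol.smooth_velocity.mono hsub3)
      (fun s hs => hsol.divFree s (hsub3 hs)) hlin'.1 hlin'.2.1 hlin'.2.2.1 hlin'.2.2.2.2 hwt a' ⟨le_rfl, ha'.2.le⟩
    refine F.hSinj ?_
    rw [hZ a' ham, hw0, ← hwt, ← hZ t htm, h0]
  -- (2) continuity at `0` and `D(g 0)(y) = id`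
  obtain ⟨-, -, -, -, -, -, hDc, -⟩ := exists_linearMild_fderiv_modelMap F hν xF hU hU' hUU' htube hy
  have hlim : Tendsto (fun s => fderiv ℝ (fun y' => F.modelMap ν xF U' s y') y h) (𝓝[>] 0)
      (𝓝 (fderiv ℝ (fun y' => F.modelMap ν xF U' 0 y') y h)) :=
    ((hDc h 0 ⟨le_rfl, zero_le_three⟩).mono_of_mem_nhdsWithin (Icc_mem_nhdsGT zero_lt_three)).tendsto
  have hev : (fun s => fderiv ℝ (fun y' => F.modelMap ν xF U' s y') y h) =ᶠ[𝓝[>] 0] fun _ => 0 :=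
    mem_of_superset (Ioo_mem_nhdsGT ht.1) fun s hs => hzero s hs
  have h00 : fderiv ℝ (fun y' => F.modelMap ν xF U' 0 y') y h = 0 :=
    tendsto_nhds_unique hlim (tendsto_const_nhds.congr' hev.symm)
  have hid0 : fderiv ℝ (fun y' => F.modelMap ν xF U' 0 y') y = ContinuousLinearMap.id ℝ Hsp := by
    rw [← fderiv_id (𝕜 := ℝ) (x := y)]
    refine Filter.EventuallyEq.fderiv_eq ?_
    filter_upwards [hU'.mem_nhds (hUU' hy)] with y' hy'
    exact F.modelMap_zero_apply ν xF hy'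
  simpa only [hid0, ContinuousLinearMap.id_apply] using h00

/-- **Tools stub S6d₂b of block N (`stub_modelDerivativeCompactInjectiveTools`) — the derivative of the model map
is a compact and injective operator at positive times.**  For a model frame `F`, `ν > 0`, the tube hypothesis on
`U ⊆ U'` and `y ∈ U` with a classical orbit on `(0, 3]` (`hclass`, produced by S6h), `D(g t)(y)`,
`g := F.modelMap ν xF U'`, is for every `t ∈ (0, 3]` COMPACT (`isCompactOperator_of_linearMild`: shifted linear mild
identity, compact Stokes semigroup `ModelFrame.isCompactOperator_T`, norm limits of compact operators) and INJECTIVE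
(`injective_fderiv_modelMap`).  The hypotheses `hxF`, `hbdd`, `hsmooth` and the attainment clauses of `hclass` are
part of the registered interface and are not needed (Constantin–Foias 1988, Ch. 14; Lian–Young 2012, §1). [folklore] -/
theorem stub_modelDerivativeCompactInjectiveTools {S : Finset (Fin 3 → ℤ)} {c : ↥S → (EuclideanSpace ℂ (Fin 3))} {ν : ℝ} (hν : 0 < ν)
    (F : ModelFrame) (xF : Hsp) (hxF : F.S xF = stateOf (force S c)) {U U' : Set Hsp} (hU : IsOpen U) (hU' : IsOpen U')
    (hbdd : Bornology.IsBounded U') (hUU' : U ⊆ U')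
    (htube : ∀ y ∈ U, ∀ t ∈ Icc (0 : ℝ) 3, ∃ (ht : 0 ≤ t) (z : C(Icc (0 : ℝ) t, Hsp)),
      F.IsMild ν xF ht y z ∧ (∀ r, z r ∈ U') ∧ F.modelMap ν xF U' t y = z ⟨t, ht, le_rfl⟩)
    (hsmooth : ∀ t ∈ Icc (0 : ℝ) 3, ContDiffOn ℝ ∞ (fun y => F.modelMap ν xF U' t y) U) {E₂ : ℝ}
    (hclass : ∀ y ∈ U, ∃ (u : ℝ → (UnitAddTorus (Fin 3)) → (EuclideanSpace ℝ (Fin 3))) (p : ℝ → (UnitAddTorus (Fin 3)) → ℝ),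
      IsClassicalNSSolutionOn (Ioc 0 3) ν (fun _ => force S c) u p ∧ (∀ t ∈ Ioc (0 : ℝ) 3, HasZeroMean (u t)) ∧
      (∀ t ∈ Ioc (0 : ℝ) 3, gradNormSq (u t) ≤ E₂) ∧ (∀ t ∈ Ioc (0 : ℝ) 3, F.S (F.modelMap ν xF U' t y) = stateOf (u t)) ∧
      Tendsto (fun t => ∫ x, ‖u t x - rep (F.S y) x‖ ^ 2) (𝓝[>] 0) (𝓝 0) ∧
      Tendsto (fun t => eGradNormSq (u t - rep (F.S y))) (𝓝[>] 0) (𝓝 0)) :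
    ∀ y ∈ U, ∀ t ∈ Ioc (0 : ℝ) 3, IsCompactOperator (fderiv ℝ (fun y' => F.modelMap ν xF U' t y') y) ∧
      Function.Injective (fderiv ℝ (fun y' => F.modelMap ν xF U' t y') y) := by
  -- `hxF`, `hbdd`, `hsmooth` are part of the registered interface; they are not needed here
  have _ : F.S xF = stateOf (force S c) ∧ Bornology.IsBounded U' ∧
      ∀ t ∈ Icc (0 : ℝ) 3, ContDiffOn ℝ ∞ (fun y => F.modelMap ν xF U' t y) U := ⟨hxF, hbdd, hsmooth⟩
  intro y hy t ht
  obtain ⟨u, p, hsol, humean, hE, horb, -, -⟩ := hclass y hy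
  refine ⟨?_, injective_fderiv_modelMap F hν xF hU hU' hUU' htube hy hsol humean hE horb ht⟩
  -- compactness: `isCompactOperator_of_linearMild` with the compact Stokes semigroup `ModelFrame.isCompactOperator_T`
  obtain ⟨B, β, M, hBn, -, hM, -, hcomp, hid⟩ := exists_linearMild_fderiv_modelMap F hν xF hU hU' hUU' htube hy
  exact isCompactOperator_of_linearMild (fun t => F.T (ν * t)) (fun t => F.K (ν * t)) (F.T_mul_add hν.le)
    (fun s hs => F.isCompactOperator_T (mul_pos hν hs)) (by norm_num : (3 / 4 : ℝ) < 1) (Real.rpow_nonneg hν.le _)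
    (F.norm_K_mul_le hν) (F.K_mul_add hν) (F.continuousOn_K_mul hν)
    (D := fun s => fderiv ℝ (fun y' => F.modelMap ν xF U' s y') y) hBn hM hcomp hid ht

end Summit.AnomalousDissipation.AnomalousDissipation.Theorems.DenseLoudDesignerForces.Ergodic

end
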